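import Mathlib
import HarnessLib

/-!
# Bendixson's theorem: the eigenvalues of `A = H₁ + i H₂` lie in the Rayleigh box

[cite: StoerBulirsch2002, §6.9 "Estimation of Eigenvalues", Theorem (6.9.15) (Bendixson) with
its derivation from the Rayleigh–Ritz characterisation (6.4.3) of §6.4]
Topic `Literature/Analysis/Calculus` (numerical-analysis anchors; eigenvalue estimates).
Every complex square matrix decomposes as `A = H₁ + i H₂` with `H₁ = (A + Aᴴ)/2` and
`H₂ = (A - Aᴴ)/(2i)` Hermitian (`bendixson_decomposition`), and for an eigenpair `A x = μ x`,
`x ≠ 0`, Bendixson's theorem states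
`λ_min(H₁) ≤ Re μ ≤ λ_max(H₁)` and `λ_min(H₂) ≤ Im μ ≤ λ_max(H₂)`.
We follow the book's proof: `Re (xᴴ A x) = xᴴ H₁ x`, `Im (xᴴ A x) = xᴴ H₂ x`
(`bendixson_re_mul_eq`, `bendixson_im_mul_eq`) and the Rayleigh–Ritz bounds (6.4.3)
`λ_min(H) · xᴴx ≤ xᴴ H x ≤ λ_max(H) · xᴴx` (`bendixson_iInf_mul_le_form`,
`bendixson_form_le_iSup_mul`), which we derive from the unitary diagonalisation
`Matrix.IsHermitian.spectral_theorem`; `λ_min`, `λ_max` are written `⨅ i, h.eigenvalues i`,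
`⨆ i, h.eigenvalues i` for `h : H.IsHermitian` (Mathlib's `Matrix.IsHermitian.eigenvalues`).
Hirsch's bound (6.9.1) `|μ| ≤ ‖A‖` is Mathlib's `spectrum.norm_le_norm_of_mem` and is not
restated. STRONGER NEIGHBOUR IN THE TREE: the real-part bounds are the case `k = 1` of Fan's
majorization `Re λ(A) ≺ λ(H(A))` (1950), typed in
`Literature/LinearAlgebra/Matrix/ConverseInterlacing` § 8
(`exists_doublyStochastic_re_eq_mulVec_eigenvalues_hermitianPart`,
`sum_re_le_sum_prefix_of_charpoly_hermitianPart_eq`, with the skew-Hermitian twin) in the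
`Fin N` / characteristic-polynomial-list form; here Bendixson's classical statement is typed for
a single eigenpair over an arbitrary finite index type, against `Matrix.IsHermitian.eigenvalues`,
with the book's elementary Rayleigh-quotient proof and no project imports. No definitions.
-/

namespace Literature.Analysis.Calculus

open Matrix

variable {n : Type*}

/-- **The Cartesian decomposition `A = H₁ + i H₂`.** For every complex square matrix `A` the
matrices `H₁ = (A + Aᴴ)/2` and `H₂ = (A - Aᴴ)/(2i) = (-i/2)(A - Aᴴ)` are Hermitian and
`A = H₁ + i H₂` (so Bendixson's bounds below apply with these `H₁`, `H₂`).
[cite: StoerBulirsch2002, §6.9, display preceding Thm. (6.9.15)] -/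
theorem bendixson_decomposition (A : Matrix n n ℂ) :
    ((2 : ℂ)⁻¹ • (A + Aᴴ)).IsHermitian ∧ ((-Complex.I / 2) • (A - Aᴴ)).IsHermitian ∧
      A = (2 : ℂ)⁻¹ • (A + Aᴴ) + Complex.I • ((-Complex.I / 2) • (A - Aᴴ)) := by
  refine ⟨?_, ?_, ?_⟩
  · show ((2 : ℂ)⁻¹ • (A + Aᴴ))ᴴ = (2 : ℂ)⁻¹ • (A + Aᴴ)
    rw [conjTranspose_smul, conjTranspose_add, conjTranspose_conjTranspose, add_comm Aᴴ A,
      star_inv₀, star_ofNat]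
  · show ((-Complex.I / 2) • (A - Aᴴ))ᴴ = (-Complex.I / 2) • (A - Aᴴ)
    have hc : star (-Complex.I / 2) = -(-Complex.I / 2) := by
      simp [neg_div]
    rw [conjTranspose_smul, conjTranspose_sub, conjTranspose_conjTranspose, hc, neg_smul,
      ← smul_neg, neg_sub]
  · have hI : Complex.I * (-Complex.I / 2) = (2 : ℂ)⁻¹ := by
      rw [mul_div_assoc', mul_neg, Complex.I_mul_I, neg_neg, one_div]
    rw [smul_smul, hI, ← smul_add, add_add_sub_cancel, ← two_smul ℂ A, smul_smul,
      inv_mul_cancel₀ two_ne_zero, one_smul]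

variable [Fintype n]

/-- `(U⋆ x)⋆ = x⋆ U` for a square matrix `U`. [folklore] -/
private theorem bendixson_star_star_mulVec (U : Matrix n n ℂ) (x : n → ℂ) :
    star (star U *ᵥ x) = star x ᵥ* U := by
  rw [star_mulVec, star_eq_conjTranspose, conjTranspose_conjTranspose]

/-- `x⋆ x = ∑ |xᵢ|²`. [folklore] -/
private theorem bendixson_star_dotProduct_self (x : n → ℂ) :
    star x ⬝ᵥ x = ((∑ i, ‖x i‖ ^ 2 : ℝ) : ℂ) := by
  rw [Complex.ofReal_sum]
  simp only [dotProduct, Pi.star_apply, Complex.star_def, Complex.conj_mul']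
  push_cast
  rfl

/-- `x ≠ 0 ⇒ 0 < Re (x⋆ x)`. [folklore] -/
private theorem bendixson_re_self_pos {x : n → ℂ} (hx : x ≠ 0) : 0 < (star x ⬝ᵥ x).re := by
  obtain ⟨i, hi⟩ := Function.ne_iff.mp hx
  rw [bendixson_star_dotProduct_self, Complex.ofReal_re]
  exact Finset.sum_pos' (fun j _ => sq_nonneg _) ⟨i, Finset.mem_univ _, by positivity⟩

/-- `Im (x⋆ x) = 0`. [folklore] -/
private theorem bendixson_im_self (x : n → ℂ) : (star x ⬝ᵥ x).im = 0 := by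
  rw [bendixson_star_dotProduct_self, Complex.ofReal_im]

/-- The quadratic form of `A = H₁ + i H₂` splits: `x⋆ A x = x⋆ H₁ x + i · x⋆ H₂ x`, and for an
eigenpair the left side is `μ · x⋆ x`. [folklore] -/
private theorem bendixson_eigen_form {A H₁ H₂ : Matrix n n ℂ} {x : n → ℂ} {μ : ℂ}
    (hA : A = H₁ + Complex.I • H₂) (hAx : A *ᵥ x = μ • x) :
    μ * (star x ⬝ᵥ x) = star x ⬝ᵥ (H₁ *ᵥ x) + Complex.I * (star x ⬝ᵥ (H₂ *ᵥ x)) := by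
  calc μ * (star x ⬝ᵥ x) = star x ⬝ᵥ (A *ᵥ x) := by rw [hAx, dotProduct_smul, smul_eq_mul]
    _ = _ := by
        rw [hA, add_mulVec, smul_mulVec, dotProduct_add, dotProduct_smul, smul_eq_mul]

variable [DecidableEq n]

section Rayleigh

variable {H : Matrix n n ℂ}

/-- Diagonalisation of the quadratic form in the coordinates `y = U⋆ x` of the unitary
eigenvector matrix `U`: `x⋆ H x = ∑ λᵢ |yᵢ|²`. [folklore] -/
private theorem bendixson_form_eq_sum (hH : H.IsHermitian) (x : n → ℂ) :
    star x ⬝ᵥ (H *ᵥ x) = ((∑ i, hH.eigenvalues i *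
      ‖(star (hH.eigenvectorUnitary : Matrix n n ℂ) *ᵥ x) i‖ ^ 2 : ℝ) : ℂ) := by
  have hHU : (hH.eigenvectorUnitary : Matrix n n ℂ) *
      diagonal (fun i => ((hH.eigenvalues i : ℝ) : ℂ)) *
        star (hH.eigenvectorUnitary : Matrix n n ℂ) = H := by
    have h := hH.spectral_theorem
    rw [Unitary.conjStarAlgAut_apply] at h
    exact h.symm
  calc star x ⬝ᵥ (H *ᵥ x)
      = star x ⬝ᵥ ((hH.eigenvectorUnitary : Matrix n n ℂ) *ᵥ
          (diagonal (fun i => ((hH.eigenvalues i : ℝ) : ℂ)) *ᵥ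
            (star (hH.eigenvectorUnitary : Matrix n n ℂ) *ᵥ x))) := by
        rw [mulVec_mulVec, mulVec_mulVec, hHU]
    _ = star (star (hH.eigenvectorUnitary : Matrix n n ℂ) *ᵥ x) ⬝ᵥ
          (diagonal (fun i => ((hH.eigenvalues i : ℝ) : ℂ)) *ᵥ
            (star (hH.eigenvectorUnitary : Matrix n n ℂ) *ᵥ x)) := by
        rw [bendixson_star_star_mulVec,
          dotProduct_mulVec (star x) (hH.eigenvectorUnitary : Matrix n n ℂ)]
    _ = ((∑ i, hH.eigenvalues i *
          ‖(star (hH.eigenvectorUnitary : Matrix n n ℂ) *ᵥ x) i‖ ^ 2 : ℝ) : ℂ) := by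
        rw [Complex.ofReal_sum]
        simp only [dotProduct, mulVec_diagonal, Pi.star_apply]
        refine Finset.sum_congr rfl fun i _ => ?_
        rw [mul_left_comm]
        simp only [Complex.star_def, Complex.conj_mul']
        push_cast
        ring

/-- Unitary invariance of the Euclidean length: `x⋆ x = ∑ |yᵢ|²` for `y = U⋆ x`. [folklore] -/
private theorem bendixson_self_eq_sum (hH : H.IsHermitian) (x : n → ℂ) :
    star x ⬝ᵥ x =
      ((∑ i, ‖(star (hH.eigenvectorUnitary : Matrix n n ℂ) *ᵥ x) i‖ ^ 2 : ℝ) : ℂ) := by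
  have hUU : (hH.eigenvectorUnitary : Matrix n n ℂ) * star (hH.eigenvectorUnitary : Matrix n n ℂ)
      = 1 := Unitary.coe_mul_star_self hH.eigenvectorUnitary
  calc star x ⬝ᵥ x
      = star x ⬝ᵥ ((hH.eigenvectorUnitary : Matrix n n ℂ) *ᵥ
          (star (hH.eigenvectorUnitary : Matrix n n ℂ) *ᵥ x)) := by
        rw [mulVec_mulVec, hUU, one_mulVec]
    _ = star (star (hH.eigenvectorUnitary : Matrix n n ℂ) *ᵥ x) ⬝ᵥ
          (star (hH.eigenvectorUnitary : Matrix n n ℂ) *ᵥ x) := by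
        rw [bendixson_star_star_mulVec,
          dotProduct_mulVec (star x) (hH.eigenvectorUnitary : Matrix n n ℂ)]
    _ = _ := bendixson_star_dotProduct_self _

/-- The Hermitian form is real: `Im (x⋆ H x) = 0`. [folklore] -/
private theorem bendixson_im_form (hH : H.IsHermitian) (x : n → ℂ) :
    (star x ⬝ᵥ (H *ᵥ x)).im = 0 := by
  rw [bendixson_form_eq_sum hH x, Complex.ofReal_im]

/-- **Rayleigh–Ritz upper bound (6.4.3).** For a Hermitian matrix `H` and every vector `x`,
`xᴴ H x ≤ λ_max(H) · xᴴ x`, with `λ_max(H) = ⨆ i, hH.eigenvalues i`.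
[cite: StoerBulirsch2002, §6.4, (6.4.3); §6.9, proof of Thm. (6.9.15)] -/
theorem bendixson_form_le_iSup_mul (hH : H.IsHermitian) (x : n → ℂ) :
    (star x ⬝ᵥ (H *ᵥ x)).re ≤ (⨆ i, hH.eigenvalues i) * (star x ⬝ᵥ x).re := by
  rw [bendixson_form_eq_sum hH x, bendixson_self_eq_sum hH x, Complex.ofReal_re,
    Complex.ofReal_re, Finset.mul_sum]
  exact Finset.sum_le_sum fun i _ =>
    mul_le_mul_of_nonneg_right (le_ciSup (Set.finite_range _).bddAbove i) (sq_nonneg _)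

/-- **Rayleigh–Ritz lower bound (6.4.3).** For a Hermitian matrix `H` and every vector `x`,
`λ_min(H) · xᴴ x ≤ xᴴ H x`, with `λ_min(H) = ⨅ i, hH.eigenvalues i`.
[cite: StoerBulirsch2002, §6.4, (6.4.3); §6.9, proof of Thm. (6.9.15)] -/
theorem bendixson_iInf_mul_le_form (hH : H.IsHermitian) (x : n → ℂ) :
    (⨅ i, hH.eigenvalues i) * (star x ⬝ᵥ x).re ≤ (star x ⬝ᵥ (H *ᵥ x)).re := by
  rw [bendixson_form_eq_sum hH x, bendixson_self_eq_sum hH x, Complex.ofReal_re,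
    Complex.ofReal_re, Finset.mul_sum]
  exact Finset.sum_le_sum fun i _ =>
    mul_le_mul_of_nonneg_right (ciInf_le (Set.finite_range _).bddBelow i) (sq_nonneg _)

end Rayleigh

section Bendixson

variable {A H₁ H₂ : Matrix n n ℂ} {x : n → ℂ} {μ : ℂ}

/-- **Real part of the Rayleigh quotient.** If `A = H₁ + i H₂` with `H₁, H₂` Hermitian and
`A x = μ x`, then `Re μ · xᴴx = xᴴ H₁ x` (the step `Re (xᴴAx/xᴴx) = xᴴH₁x/xᴴx` of the proof).
[cite: StoerBulirsch2002, §6.9, Thm. (6.9.15) (proof)] -/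
theorem bendixson_re_mul_eq (h₁ : H₁.IsHermitian) (h₂ : H₂.IsHermitian)
    (hA : A = H₁ + Complex.I • H₂) (hAx : A *ᵥ x = μ • x) :
    μ.re * (star x ⬝ᵥ x).re = (star x ⬝ᵥ (H₁ *ᵥ x)).re := by
  have hq := congrArg Complex.re (bendixson_eigen_form hA hAx)
  simp only [Complex.mul_re, Complex.add_re, Complex.I_re, Complex.I_im, bendixson_im_self x,
    bendixson_im_form h₂ x, mul_zero, sub_zero, zero_mul] at hq
  have := bendixson_im_form h₁ x
  linarith

/-- **Imaginary part of the Rayleigh quotient.** If `A = H₁ + i H₂` with `H₁, H₂` Hermitian and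
`A x = μ x`, then `Im μ · xᴴx = xᴴ H₂ x`.
[cite: StoerBulirsch2002, §6.9, Thm. (6.9.15) (proof)] -/
theorem bendixson_im_mul_eq (h₁ : H₁.IsHermitian) (h₂ : H₂.IsHermitian)
    (hA : A = H₁ + Complex.I • H₂) (hAx : A *ᵥ x = μ • x) :
    μ.im * (star x ⬝ᵥ x).re = (star x ⬝ᵥ (H₂ *ᵥ x)).re := by
  have hq := congrArg Complex.im (bendixson_eigen_form hA hAx)
  simp only [Complex.mul_im, Complex.add_im, Complex.I_re, Complex.I_im, bendixson_im_self x,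
    bendixson_im_form h₁ x, bendixson_im_form h₂ x, mul_zero, zero_add, one_mul] at hq
  linarith

/-- **Bendixson's theorem (6.9.15), real part, upper bound.** If `A = H₁ + i H₂` with `H₁, H₂`
Hermitian, then every eigenvalue `μ` of `A` satisfies `Re μ ≤ λ_max(H₁)`.
[cite: StoerBulirsch2002, §6.9, Thm. (6.9.15)] -/
theorem bendixson_re_le_iSup (h₁ : H₁.IsHermitian) (h₂ : H₂.IsHermitian)
    (hA : A = H₁ + Complex.I • H₂) (hx : x ≠ 0) (hAx : A *ᵥ x = μ • x) :
    μ.re ≤ ⨆ i, h₁.eigenvalues i := by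
  have h := bendixson_form_le_iSup_mul h₁ x
  rw [← bendixson_re_mul_eq h₁ h₂ hA hAx] at h
  exact le_of_mul_le_mul_right h (bendixson_re_self_pos hx)

/-- **Bendixson's theorem (6.9.15), real part, lower bound.** If `A = H₁ + i H₂` with `H₁, H₂`
Hermitian, then every eigenvalue `μ` of `A` satisfies `λ_min(H₁) ≤ Re μ`.
[cite: StoerBulirsch2002, §6.9, Thm. (6.9.15)] -/
theorem bendixson_iInf_le_re (h₁ : H₁.IsHermitian) (h₂ : H₂.IsHermitian)
    (hA : A = H₁ + Complex.I • H₂) (hx : x ≠ 0) (hAx : A *ᵥ x = μ • x) :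
    ⨅ i, h₁.eigenvalues i ≤ μ.re := by
  have h := bendixson_iInf_mul_le_form h₁ x
  rw [← bendixson_re_mul_eq h₁ h₂ hA hAx] at h
  exact le_of_mul_le_mul_right h (bendixson_re_self_pos hx)

/-- **Bendixson's theorem (6.9.15), imaginary part, upper bound.** If `A = H₁ + i H₂` with
`H₁, H₂` Hermitian, then every eigenvalue `μ` of `A` satisfies `Im μ ≤ λ_max(H₂)`.
[cite: StoerBulirsch2002, §6.9, Thm. (6.9.15)] -/
theorem bendixson_im_le_iSup (h₁ : H₁.IsHermitian) (h₂ : H₂.IsHermitian)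
    (hA : A = H₁ + Complex.I • H₂) (hx : x ≠ 0) (hAx : A *ᵥ x = μ • x) :
    μ.im ≤ ⨆ i, h₂.eigenvalues i := by
  have h := bendixson_form_le_iSup_mul h₂ x
  rw [← bendixson_im_mul_eq h₁ h₂ hA hAx] at h
  exact le_of_mul_le_mul_right h (bendixson_re_self_pos hx)

/-- **Bendixson's theorem (6.9.15), imaginary part, lower bound.** If `A = H₁ + i H₂` with
`H₁, H₂` Hermitian, then every eigenvalue `μ` of `A` satisfies `λ_min(H₂) ≤ Im μ`.
[cite: StoerBulirsch2002, §6.9, Thm. (6.9.15)] -/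
theorem bendixson_iInf_le_im (h₁ : H₁.IsHermitian) (h₂ : H₂.IsHermitian)
    (hA : A = H₁ + Complex.I • H₂) (hx : x ≠ 0) (hAx : A *ᵥ x = μ • x) :
    ⨅ i, h₂.eigenvalues i ≤ μ.im := by
  have h := bendixson_iInf_mul_le_form h₂ x
  rw [← bendixson_im_mul_eq h₁ h₂ hA hAx] at h
  exact le_of_mul_le_mul_right h (bendixson_re_self_pos hx)

/-- **Bendixson's theorem (6.9.15) for the canonical parts.** Every eigenvalue `μ` of a
complex square matrix `A` has real part between the extreme eigenvalues of
`Re A = (A + Aᴴ)/2` and imaginary part between those of `Im A = (A - Aᴴ)/(2i)`.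
[cite: StoerBulirsch2002, §6.9, Thm. (6.9.15)] -/
theorem bendixson_eigenvalue_box (A : Matrix n n ℂ) (hx : x ≠ 0) (hAx : A *ᵥ x = μ • x) :
    (⨅ i, (bendixson_decomposition A).1.eigenvalues i ≤ μ.re ∧
      μ.re ≤ ⨆ i, (bendixson_decomposition A).1.eigenvalues i) ∧
    (⨅ i, (bendixson_decomposition A).2.1.eigenvalues i ≤ μ.im ∧
      μ.im ≤ ⨆ i, (bendixson_decomposition A).2.1.eigenvalues i) :=
  have hd := bendixson_decomposition A
  ⟨⟨bendixson_iInf_le_re hd.1 hd.2.1 hd.2.2 hx hAx,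
      bendixson_re_le_iSup hd.1 hd.2.1 hd.2.2 hx hAx⟩,
    ⟨bendixson_iInf_le_im hd.1 hd.2.1 hd.2.2 hx hAx,
      bendixson_im_le_iSup hd.1 hd.2.1 hd.2.2 hx hAx⟩⟩

end Bendixson

end Literature.Analysis.Calculus
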